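import Summits.Schanuel.Schanuel.Theorems.RootDecomp1KHyper09

/-!
# RootDecomp1KHyper — part 10 of the «HyperCarving» port wave (lens 6, gen 9 = ROUND 4 of route-Schanuel-RootDecomp1K; 19 parts planned)

Mechanical port (census-1 gen 7, dependency closure; tools census/tools/gen7/portkit2.py + build_l6g9.py) of §17 of HOME/decomp-schanuel-lens-6/g9/HyperCarving.lean
(sha256 aba5c91f…, 8041 l; critic CLEARED FOR TYPING 2026-08-30T13:33:07Z; writer PATH A″ rev 5–8) together with the §§0–16 declarations it depends on
(nothing of the node was in the tree before except RootDecomp1KLinLiouvilleSplit and the Literature fact NesterenkoWaldschmidt1996_thm_5_1).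
This part: node lines 4812–5139 (7 declarations: algebraicIndependent_three_of_hyperLiouville, Ewt, exC, coC, AC, FC …).
All parts share the namespace `Summit.Schanuel.Schanuel.Theorems.RootDecomp1KHyper` (node sub-namespace `HyperCell` reproduced); statements and proofs
are the node's verbatim; `--supports stmt-Schanuel-33363` (A₄ʰ HyperLiouvilleSchanuel). Sorry-free; standard axioms. Nothing here proves Schanuel; rung 0.
-/

set_option linter.dupNamespace false
set_option linter.unusedSectionVars false

noncomputable section

open Complex IntermediateField Filter Polynomial

namespace Summit.Schanuel.Schanuel.Theorems.RootDecomp1KHyper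

variable {n K : ℕ}

namespace HyperCell

variable {n K : ℕ}

/-- §16b. Roots: a root within ‖A(w)‖^{1/N}, Gauss, Mahler: auxiliary statement `one_le_mahlerMeasure_map_of_ne_zero` (lens 6 gen 9 node, ported verbatim). -/
private theorem one_le_mahlerMeasure_map_of_ne_zero {R : ℤ[X]} (hR : R ≠ 0) :
    1 ≤ (R.map (Int.castRingHom ℂ)).mahlerMeasure := by
  refine one_le_mahlerMeasure_of_one_le_norm_leadingCoeff ?_
  rw [Polynomial.leadingCoeff_map_of_injective (RingHom.injective_int _), eq_intCast,
    Complex.norm_intCast]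
  exact_mod_cast Int.one_le_abs (Polynomial.leadingCoeff_ne_zero.mpr hR)

/-- §16b. Roots: a root within ‖A(w)‖^{1/N}, Gauss, Mahler: auxiliary statement `mahlerMeasure_le_of_dvd` (lens 6 gen 9 node, ported verbatim). -/
private theorem mahlerMeasure_le_of_dvd {Q A : ℤ[X]} (hdvd : Q ∣ A) (hA : A ≠ 0) :
    (Q.map (Int.castRingHom ℂ)).mahlerMeasure ≤ (A.map (Int.castRingHom ℂ)).mahlerMeasure := by
  obtain ⟨R, rfl⟩ := hdvd
  have hR : R ≠ 0 := right_ne_zero_of_mul hA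
  rw [Polynomial.map_mul, mahlerMeasure_mul]
  calc (Q.map (Int.castRingHom ℂ)).mahlerMeasure = (Q.map (Int.castRingHom ℂ)).mahlerMeasure * 1 :=
        (mul_one _).symm
    _ ≤ _ := mul_le_mul_of_nonneg_left (one_le_mahlerMeasure_map_of_ne_zero hR)
        (mahlerMeasure_nonneg _)

/-- §16c. Numerical lemmas: auxiliary statement `log_le_self_of_nonneg` (lens 6 gen 9 node, ported verbatim). -/
private theorem log_le_self_of_nonneg {x : ℝ} (h0 : 0 ≤ x) : Real.log x ≤ x := by
  rcases eq_or_lt_of_le h0 with h | h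
  · rw [← h, Real.log_zero]
  · linarith [Real.log_le_sub_one_of_pos h]

/-- §16d. The theorem: auxiliary statement `eval_map_intCast` (lens 6 gen 9 node, ported verbatim). -/
private theorem eval_map_intCast (P : ℤ[X]) (x : ℂ) : (P.map (Int.castRingHom ℂ)).eval x = aeval x P := by
  rw [Polynomial.eval_map, Polynomial.aeval_def, algebraMap_int_eq]

/-- §16f. Level 3 with e^ℓ load-bearing: (ℓ, e, e^ℓ) for hyper-Liouville ℓ > 0: auxiliary statement `apply_le_totalDegree` (lens 6 gen 9 node, ported verbatim). -/
private theorem apply_le_totalDegree {P : MvPolynomial (Fin 3) ℤ} {s : Fin 3 →₀ ℕ} (hs : s ∈ P.support)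
    (i : Fin 3) : s i ≤ P.totalDegree := by
  refine le_trans ?_ (MvPolynomial.le_totalDegree hs)
  by_cases hi : i ∈ s.support
  · exact Finset.single_le_sum (f := fun j => s j) (fun _ _ => Nat.zero_le _) hi
  · simp [Finsupp.notMem_support_iff.mp hi]

set_option maxHeartbeats 800000 in
/-- **Theorem (level 3, mod the support statement `hX`).** For a hyper-Liouville real `ℓ > 0`,
the three numbers `ℓ, e, e^ℓ` are algebraically independent over `ℚ` — a decided storey in which
`e^ℓ` (and `e`) is load-bearing and NO measured partner is present. -/
theorem algebraicIndependent_three_of_hyperLiouville (hX : ExplicitRatExpApprox) {ℓ : ℝ}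
    (hℓ : HyperLiouville ℓ) (hℓ0 : 0 < ℓ) :
    AlgebraicIndependent ℚ ![(ℓ : ℂ), cexp 1, cexp ℓ] := by
  by_contra hdep
  -- an integer relation `P(ℓ, e, e^ℓ) = 0`, `P ≠ 0`
  obtain ⟨P, hP0, hPu⟩ : ∃ P : MvPolynomial (Fin 3) ℤ, P ≠ 0 ∧
      MvPolynomial.aeval ![(ℓ : ℂ), cexp 1, cexp ℓ] P = 0 := by
    have h1 : ¬ Function.Injective
        (MvPolynomial.aeval ![(ℓ : ℂ), cexp 1, cexp ℓ] : MvPolynomial (Fin 3) ℚ →ₐ[ℚ] ℂ) := hdep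
    rw [injective_iff_map_eq_zero] at h1
    push Not at h1
    obtain ⟨g, hg0, hgne⟩ := h1
    obtain ⟨N, G, hN, hG⟩ := exists_int_mul_eq_map g
    refine ⟨G, ?_, ?_⟩
    · intro hG0
      rw [hG0, map_zero] at hG
      have hC : (MvPolynomial.C (N : ℚ) : MvPolynomial (Fin 3) ℚ) ≠ 0 :=
        MvPolynomial.C_eq_zero.not.mpr (by exact_mod_cast hN)
      exact (mul_ne_zero hC hgne) hG.symm
    · rw [← mvaeval_int_map _ G, hG, map_mul, MvPolynomial.aeval_C, hg0, mul_zero]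
  have hFℓ : F3 P ℓ = 0 := by
    have h : ((F3 P ℓ : ℝ) : ℂ) = 0 := by rw [F3_cast]; exact hPu
    exact_mod_cast h
  -- the total degree, a monomial of the support and its fibre polynomial
  set d : ℕ := P.totalDegree with hd
  obtain ⟨t, ht⟩ : ∃ t, t ∈ P.support := by
    obtain ⟨t, ht⟩ := MvPolynomial.ne_zero_iff.mp hP0
    exact ⟨t, MvPolynomial.mem_support_iff.mpr ht⟩
  have hg0 : fib3 P t ≠ 0 := fib3_ne_zero P ht
  obtain ⟨δ₀, hδ₀, hball⟩ := exists_ball_eval_ne_zero ((fib3 P t).map (Int.castRingHom ℂ))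
    ((Polynomial.map_ne_zero_iff (RingHom.injective_int _)).mpr hg0) ℓ
  -- local Lipschitz bound of `x ↦ P(x, e, e^x)` at `ℓ`
  obtain ⟨Kl, δ₁, hKl0, hδ₁, hlipF⟩ := exists_lipschitz_F3 P ℓ
  set M : ℝ := Kl + 1 with hM
  have hM0 : 0 < M := by rw [hM]; linarith
  -- constants (depend on `ℓ` and `P` only)
  have hmv0 : (0 : ℝ) ≤ (mvlen P : ℝ) := by exact_mod_cast mvlen_nonneg P
  set Sr : ℝ := ((mvlen P : ℤ) : ℝ) + 1 with hSr
  have hSr1 : 1 ≤ Sr := by rw [hSr]; linarith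
  have hlogSr : 0 ≤ Real.log Sr := Real.log_nonneg hSr1
  set cN : ℝ := (ℓ + 2) * d + 1 with hcN
  have hcN1 : 1 ≤ cN := by rw [hcN]; nlinarith [hℓ0.le, (Nat.cast_nonneg d : (0 : ℝ) ≤ d)]
  have hcN0 : 0 ≤ cN := by linarith
  set c0 : ℝ := 1280000000 * 4 * 27 ^ 2 with hc0
  set cY : ℝ := (d : ℝ) * (ℓ + 2) + Real.log Sr + 3 with hcY
  have hcY0 : 0 ≤ cY := by positivity
  set c : ℝ := c0 * (cN ^ 2 * (1 + cN) ^ 2) * cY with hc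
  have hc0' : 0 ≤ c := by positivity
  set C : ℝ := cN * c + d + M + 1 + |Real.log δ₀| + |Real.log δ₁| + |Real.log ℓ| with hC
  have hCend : cN * c + d + M + 1 ≤ C := by
    rw [hC]; linarith [abs_nonneg (Real.log δ₀), abs_nonneg (Real.log δ₁), abs_nonneg (Real.log ℓ)]
  have hC0 : 0 ≤ C := by
    have : 0 ≤ cN * c := by positivity
    linarith [hM0.le, (Nat.cast_nonneg d : (0 : ℝ) ≤ d)]
  have hCd : (d : ℝ) + 1 ≤ C := by
    have : 0 ≤ cN * c := by positivity
    linarith [hM0.le]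
  set m : ℕ := ⌈C⌉₊ + 8 with hm
  -- the approximation `r = p/q`: `q ≥ m`, `|ℓ − r| < exp(−q^m)`
  obtain ⟨r, hden, hne, hlt⟩ := hℓ m
  set q : ℕ := r.den with hq
  have hq8 : 8 ≤ q := le_trans (by omega) hden
  have hq1 : 1 ≤ q := by omega
  have hq0 : q ≠ 0 := by omega
  have hqC : (q : ℂ) ≠ 0 := by exact_mod_cast hq0
  have hq1r : (1 : ℝ) ≤ q := by exact_mod_cast hq1
  have hq2r : (2 : ℝ) ≤ q := by exact_mod_cast (show 2 ≤ q by omega)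
  have hCm : C ≤ (m : ℝ) := by
    rw [hm, Nat.cast_add, Nat.cast_ofNat]; linarith [Nat.le_ceil C]
  have hmq : (m : ℝ) ≤ q := by exact_mod_cast hden
  have hCq : C ≤ (q : ℝ) := hCm.trans hmq
  have hdq : d < q := by
    have : (d : ℝ) + 1 ≤ q := hCd.trans hCq
    exact_mod_cast (by linarith : (d : ℝ) < q)
  set η : ℝ := |ℓ - r| with hη
  have hη0 : 0 < η := abs_pos.mpr (sub_ne_zero.mpr hne)
  have hηlt : η < Real.exp (-((q : ℝ) ^ m)) := hlt
  have hqm1 : (q : ℝ) ≤ (q : ℝ) ^ m := le_self_pow₀ hq1r (by omega)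
  have hηC : η < Real.exp (-C) := hηlt.trans_le (Real.exp_le_exp.mpr (by linarith))
  have hη_of : ∀ x : ℝ, 0 < x → |Real.log x| ≤ C → η < x := by
    intro x hx hlx
    refine hηC.trans_le ?_
    calc Real.exp (-C) ≤ Real.exp (Real.log x) :=
          Real.exp_le_exp.mpr (by linarith [neg_abs_le (Real.log x)])
      _ = x := Real.exp_log hx
  have hcNc0 : 0 ≤ cN * c := by positivity
  have hηδ₀ : η < δ₀ := hη_of δ₀ hδ₀ (by
    rw [hC]; linarith [abs_nonneg (Real.log δ₁), abs_nonneg (Real.log ℓ), hM0.le,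
      (Nat.cast_nonneg d : (0 : ℝ) ≤ d)])
  have hηδ₁ : η < δ₁ := hη_of δ₁ hδ₁ (by
    rw [hC]; linarith [abs_nonneg (Real.log δ₀), abs_nonneg (Real.log ℓ), hM0.le,
      (Nat.cast_nonneg d : (0 : ℝ) ≤ d)])
  have hηℓ : η < ℓ := hη_of ℓ hℓ0 (by
    rw [hC]; linarith [abs_nonneg (Real.log δ₀), abs_nonneg (Real.log δ₁), hM0.le,
      (Nat.cast_nonneg d : (0 : ℝ) ≤ d)])
  have hη1 : η ≤ 1 := by
    refine hηC.le.trans ?_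
    rw [Real.exp_le_one_iff]; linarith
  -- `r > 0`, `r = p/q` with `p ∈ ℕ`, `gcd(p, q) = 1`
  have hr0 : 0 < r := by
    have h1 : |ℓ - r| < ℓ := hηℓ
    have h2 : (0 : ℝ) < r := by
      have := abs_lt.mp h1; linarith [this.2]
    exact_mod_cast h2
  set p : ℕ := r.num.natAbs with hp
  have hpnum : (p : ℤ) = r.num := by
    rw [hp]; exact Int.natAbs_of_nonneg (Rat.num_pos.mpr hr0).le
  have hcop : Nat.Coprime p q := r.reduced
  have hrq : (r : ℝ) = (p : ℝ) / q := by
    rw [Rat.cast_def, hq, show ((r.num : ℤ) : ℝ) = (p : ℝ) by rw [← hpnum]; simp]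
  have hrC : ((r : ℝ) : ℂ) = (p : ℂ) / q := by
    rw [hrq, Complex.ofReal_div, Complex.ofReal_natCast, Complex.ofReal_natCast]
  have hpq : (p : ℝ) ≤ (ℓ + 1) * q := by
    have hq0r : (q : ℝ) ≠ 0 := by positivity
    have h1 : (p : ℝ) = (r : ℝ) * q := by rw [hrq]; field_simp
    have h2 : (r : ℝ) ≤ ℓ + 1 := by
      have := abs_le.mp hη1; linarith [this.1]
    rw [h1]
    exact mul_le_mul_of_nonneg_right h2 (by positivity)
  -- `q^m ≥ C q⁸`
  have hpowC : C ≤ (q : ℝ) ^ ⌈C⌉₊ :=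
    calc C ≤ ⌈C⌉₊ := Nat.le_ceil C
      _ ≤ (2 : ℝ) ^ ⌈C⌉₊ := by exact_mod_cast (Nat.lt_two_pow_self).le
      _ ≤ (q : ℝ) ^ ⌈C⌉₊ := pow_le_pow_left₀ (by norm_num) hq2r _
  have hqm : C * (q : ℝ) ^ 8 ≤ (q : ℝ) ^ m := by
    rw [hm, pow_add]
    exact mul_le_mul_of_nonneg_right hpowC (by positivity)
  -- the univariate polynomial `A = q^d P(p/q, T^q, T^p)`
  have hD : ∀ s ∈ P.support, s 0 ≤ d := fun s hs => apply_le_totalDegree hs 0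
  have hN1 : ∀ s ∈ P.support, ex3 q p s ≤ q * d + p * d := fun s hs =>
    Nat.add_le_add (Nat.mul_le_mul_left _ (apply_le_totalDegree hs 1))
      (Nat.mul_le_mul_left _ (apply_le_totalDegree hs 2))
  have hinj : ∀ s ∈ P.support, ex3 q p s = ex3 q p t → s 1 = t 1 ∧ s 2 = t 2 :=
    fun s hs h => ex3_inj hcop hdq (apply_le_totalDegree hs 2) (apply_le_totalDegree ht 2) h
  set A : ℤ[X] := A3 P d p q with hAdef
  have hgr : aeval ((p : ℂ) / q) (fib3 P t) ≠ 0 := by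
    have h := hball r (fun h => hne h.symm) (by rw [abs_sub_comm]; exact hηδ₀)
    rwa [eval_map_intCast, hrC] at h
  have hAcoef : A.coeff (ex3 q p t) ≠ 0 := by
    intro h0
    have h1 := coeff_A3_ex3_cast P hD hq0 (t := t) hinj
    rw [← hAdef, h0, Int.cast_zero] at h1
    exact (mul_ne_zero (pow_ne_zero _ hqC) hgr) h1.symm
  have hA0 : A ≠ 0 := fun h => hAcoef (by rw [h, Polynomial.coeff_zero])
  have hAdeg : A.natDegree ≤ q * d + p * d := natDegree_A3_le P d p q hN1
  -- its value at `γ = e^{1/q}`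
  set γ : ℂ := cexp ((q : ℂ)⁻¹) with hγ
  have hγq : γ ^ q = cexp 1 := by rw [hγ, ← Complex.exp_nat_mul, mul_inv_cancel₀ hqC]
  have hγp : γ ^ p = cexp ((r : ℝ) : ℂ) := by
    rw [hγ, ← Complex.exp_nat_mul, hrC, div_eq_mul_inv]
  have hAγ : aeval γ A = (q : ℂ) ^ d * ((F3 P r : ℝ) : ℂ) := by
    rw [hAdef, aeval_A3 P hD hq0, hγq, hγp, ← hrC, F3_cast]
  have hAγ_le : ‖aeval γ A‖ ≤ (q : ℝ) ^ d * M * η := by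
    rw [hAγ, norm_mul, norm_pow, Complex.norm_natCast, Complex.norm_real, Real.norm_eq_abs]
    have h1 : |F3 P r| ≤ M * η := by
      have h2 := hlipF r (by rw [abs_sub_comm]; exact hηδ₁)
      rw [hFℓ, sub_zero, abs_sub_comm] at h2
      calc |F3 P r| ≤ Kl * η := h2
        _ ≤ M * η := mul_le_mul_of_nonneg_right (by rw [hM]; linarith) hη0.le
    calc (q : ℝ) ^ d * |F3 P r| ≤ (q : ℝ) ^ d * (M * η) := by gcongr
      _ = (q : ℝ) ^ d * M * η := by ring
  have hNA : (A.natDegree : ℝ) ≤ cN * q := by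
    have h1 : (A.natDegree : ℝ) ≤ q * d + p * d := by exact_mod_cast hAdeg
    have h2 : (p : ℝ) * d ≤ (ℓ + 1) * q * d := mul_le_mul_of_nonneg_right hpq (Nat.cast_nonneg _)
    have h3 : (q : ℝ) * d + (ℓ + 1) * q * d = (ℓ + 2) * d * q := by ring
    have h4 : ((ℓ + 2) * d) * (q : ℝ) ≤ cN * q :=
      mul_le_mul_of_nonneg_right (by rw [hcN]; linarith) (by positivity)
    linarith
  rcases Nat.eq_zero_or_pos A.natDegree with hNA0 | hNApos
  · -- `A` is a non-zero constant: `1 ≤ |A| = |A(γ)| ≤ q^d M η`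
    have ha : A = Polynomial.C (A.coeff 0) := Polynomial.eq_C_of_natDegree_eq_zero hNA0
    have ha0 : A.coeff 0 ≠ 0 := fun h => hA0 (by rw [ha, h, map_zero])
    have h1 : (1 : ℝ) ≤ ‖aeval γ A‖ := by
      rw [ha, aeval_C, algebraMap_int_eq, eq_intCast, Complex.norm_intCast]
      exact_mod_cast Int.one_le_abs ha0
    refine endgame₃ (N := 0) (D := d) (δ := 1) (Φ := 0) (cN := cN) hq1 hc0' hM0 (by simp; positivity)
      (by simp) (by positivity) ?_ hηlt hCend hqm
    rw [pow_zero]; exact h1.trans hAγ_le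
  -- a root `ξ` of `A` with `‖γ − ξ‖^{deg A} ≤ ‖A(γ)‖`
  set AC : ℂ[X] := A.map (Int.castRingHom ℂ) with hAC
  have hACdeg : AC.natDegree = A.natDegree := by
    rw [hAC, Polynomial.natDegree_map_eq_of_injective (RingHom.injective_int _)]
  have hAClead : 1 ≤ ‖AC.leadingCoeff‖ := by
    rw [hAC, Polynomial.leadingCoeff_map_of_injective (RingHom.injective_int _), eq_intCast,
      Complex.norm_intCast]
    exact_mod_cast Int.one_le_abs (Polynomial.leadingCoeff_ne_zero.mpr hA0)
  obtain ⟨ξ, hξroot, hξle⟩ :=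
    exists_root_pow_le_norm_eval AC hAClead (by rw [hACdeg]; exact hNApos) γ
  rw [hACdeg, hAC, eval_map_intCast] at hξle
  have hAξ : aeval ξ A = 0 := by
    have h := hξroot
    rw [Polynomial.IsRoot.def, hAC, eval_map_intCast] at h
    exact h
  -- the minimal polynomial `Q` of `ξ` divides `A`
  have hξalg : IsAlgebraic ℚ ξ := (IsFractionRing.isAlgebraic_iff ℤ ℚ ℂ).mp ⟨A, hA0, hAξ⟩
  obtain ⟨Q, hQirr, hQdeg, hQξ⟩ :=
    Literature.NumberTheory.Transcendental.NesterenkoWaldschmidt1996.exists_irreducible_int_aeval_eq_zero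
      hξalg
  have hQA : Q ∣ A := dvd_of_irreducible_of_common_root hQirr hQdeg hQξ hAξ
  have hnA : Q.natDegree ≤ A.natDegree := Polynomial.natDegree_le_of_dvd hQA hA0
  have hnN1 : Q.natDegree ≤ q * d + p * d := hnA.trans hAdeg
  -- heights: `M(Q) ≤ M(A) ≤ L(A) ≤ (p+q)^d (mvlen P + 1) =: L`
  set L : ℝ := (((p : ℤ) + q : ℤ) : ℝ) ^ d * Sr with hL
  have hpqR : (((p : ℤ) + q : ℤ) : ℝ) = (p : ℝ) + q := by
    rw [Int.cast_add, Int.cast_natCast, Int.cast_natCast]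
  have hpq1 : (1 : ℝ) ≤ (((p : ℤ) + q : ℤ) : ℝ) := by
    rw [hpqR]; linarith [(Nat.cast_nonneg p : (0 : ℝ) ≤ p)]
  have hL1 : 1 ≤ L := one_le_mul_of_one_le_of_one_le (one_le_pow₀ hpq1) hSr1
  have hMQ : (Q.map (Int.castRingHom ℂ)).mahlerMeasure ≤ L := by
    refine (mahlerMeasure_le_of_dvd hQA hA0).trans ((mahlerMeasure_map_le_sum hAdeg).trans ?_)
    have h1 := sum_abs_coeff_A3_le P hD hN1
    have h2 : (∑ j ∈ Finset.range (q * d + p * d + 1), |(A.coeff j : ℝ)|) ≤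
        (((p : ℤ) + q : ℤ) : ℝ) ^ d * (mvlen P : ℝ) := by
      rw [hAdef]; exact_mod_cast h1
    refine h2.trans ?_
    rw [hL]
    exact mul_le_mul_of_nonneg_left (by rw [hSr]; linarith) (by positivity)
  set Y : ℝ := Real.log 16 + Real.log L with hY
  have hlogL0 : 0 ≤ Real.log L := Real.log_nonneg hL1
  have hlog16 : 0 ≤ Real.log 16 := Real.log_nonneg (by norm_num)
  have h16Y : Real.log 16 ≤ Y := by rw [hY]; linarith
  have hMQY : Real.log (Q.map (Int.castRingHom ℂ)).mahlerMeasure ≤ Y := by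
    have hMpos : 0 < (Q.map (Int.castRingHom ℂ)).mahlerMeasure :=
      mahlerMeasure_pos_of_ne_zero
        ((Polynomial.map_ne_zero_iff (RingHom.injective_int _)).mpr hQirr.ne_zero)
    have := Real.log_le_log hMpos hMQ
    rw [hY]; linarith
  -- THE MEASURE at the rational exponent `1/q`
  set r' : ℚ := (q : ℚ)⁻¹ with hr'
  have hr'0 : r' ≠ 0 := by rw [hr']; exact inv_ne_zero (by exact_mod_cast hq0)
  have hr'C : cexp (r' : ℂ) = γ := by rw [hr', hγ]; push_cast; rfl
  have hr'den : r'.den = q := by rw [hr', Rat.inv_natCast_den, if_neg hq0]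
  have hXr := hX r' hr'0 Q hQirr hQdeg ξ hQξ Y h16Y hMQY
  rw [hr'C] at hXr
  -- `Φ ≤ c q⁷`
  have hYq : Y ≤ cY * q := by
    have hlogL : Real.log L = d * Real.log (((p : ℤ) + q : ℤ) : ℝ) + Real.log Sr := by
      rw [hL, Real.log_mul (by positivity) (by positivity), Real.log_pow]
    have h1 : Real.log (((p : ℤ) + q : ℤ) : ℝ) ≤ (ℓ + 2) * q := by
      refine (log_le_self_of_nonneg (by linarith)).trans ?_
      rw [hpqR]
      have : (ℓ + 1) * (q : ℝ) + q = (ℓ + 2) * q := by ring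
      linarith [hpq]
    have h2 : (d : ℝ) * Real.log (((p : ℤ) + q : ℤ) : ℝ) ≤ d * ((ℓ + 2) * q) :=
      mul_le_mul_of_nonneg_left h1 (by positivity)
    have h3 : Real.log Sr ≤ Real.log Sr * q := le_mul_of_one_le_right hlogSr hq1r
    have h4 : Real.log 16 ≤ 3 * q := by linarith [log_sixteen_lt_three]
    have hexp : ((d : ℝ) * (ℓ + 2) + Real.log Sr + 3) * q =
        d * ((ℓ + 2) * q) + Real.log Sr * q + 3 * q := by ring
    rw [hY, hlogL, hcY, hexp]
    linarith
  have hΦ : C₀rat r' * (Q.natDegree : ℝ) ^ 2 * Y *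
      (Real.log Y + Real.log Q.natDegree) ^ 2 / Real.log Y ^ 2 ≤ c * (q : ℝ) ^ 7 := by
    have h1 : C₀rat r' ≤ c0 * (q : ℝ) ^ 2 := by
      have h := C₀rat_le (ρ := 0) (r := r') (by
        rw [zero_sub, abs_neg, hr']; push_cast
        rw [abs_inv, Nat.abs_cast]
        exact inv_le_one_of_one_le₀ hq1r)
      rw [hr'den, abs_zero] at h
      rw [hc0]; convert h using 1; ring
    have h2 := measure_factor_le hQdeg hnN1 h16Y
    have hY0 : 0 < Y := lt_of_lt_of_le (Real.log_pos (by norm_num)) h16Y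
    have hC₀0 : 0 ≤ C₀rat r' := by unfold C₀rat; positivity
    have hN1r : ((q * d + p * d : ℕ) : ℝ) ≤ cN * q := by
      rw [Nat.cast_add, Nat.cast_mul, Nat.cast_mul]
      have h2' : (p : ℝ) * d ≤ (ℓ + 1) * q * d := mul_le_mul_of_nonneg_right hpq (Nat.cast_nonneg _)
      have h4 : ((ℓ + 2) * d) * (q : ℝ) ≤ cN * q :=
        mul_le_mul_of_nonneg_right (by rw [hcN]; linarith) (by positivity)
      have h5 : (q : ℝ) * d + (ℓ + 1) * q * d = ((ℓ + 2) * d) * q := by ring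
      linarith
    have hN1r' : (1 : ℝ) + ((q * d + p * d : ℕ) : ℝ) ≤ (1 + cN) * q := by
      rw [add_mul, one_mul]; linarith
    have hfac : (((q * d + p * d : ℕ) : ℝ)) ^ 2 * (1 + ((q * d + p * d : ℕ) : ℝ)) ^ 2 * Y ≤
        (cN * q) ^ 2 * ((1 + cN) * q) ^ 2 * (cY * q) := by
      gcongr
    calc C₀rat r' * (Q.natDegree : ℝ) ^ 2 * Y * (Real.log Y + Real.log Q.natDegree) ^ 2 /
          Real.log Y ^ 2
        = C₀rat r' * ((Q.natDegree : ℝ) ^ 2 * Y * (Real.log Y + Real.log Q.natDegree) ^ 2 /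
            Real.log Y ^ 2) := by ring
      _ ≤ (c0 * (q : ℝ) ^ 2) *
          ((((q * d + p * d : ℕ) : ℝ)) ^ 2 * (1 + ((q * d + p * d : ℕ) : ℝ)) ^ 2 * Y) :=
          mul_le_mul h1 h2 (by positivity) (by positivity)
      _ ≤ (c0 * (q : ℝ) ^ 2) * ((cN * q) ^ 2 * ((1 + cN) * q) ^ 2 * (cY * q)) := by gcongr
      _ = c * (q : ℝ) ^ 7 := by rw [hc]; ring
  have hlow : Real.exp (-(C₀rat r' * (Q.natDegree : ℝ) ^ 2 * Y *
      (Real.log Y + Real.log Q.natDegree) ^ 2 / Real.log Y ^ 2)) ≤ ‖γ - ξ‖ := hXr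
  have hδ : ‖γ - ξ‖ ^ A.natDegree ≤ (q : ℝ) ^ d * M * η := hξle.trans hAγ_le
  exact endgame₃ hq1 hc0' hM0 hNA hlow hΦ hδ hηlt hCend hqm

/-- `Eᵢ = p^{i+1} q^{n−(i+1)}`, the exponent of `γ = e^{1/qⁿ}` representing `e^{(p/q)^{i+1}}` -/
def Ewt (n q p : ℕ) (i : Fin n) : ℕ := p ^ ((i : ℕ) + 1) * q ^ (n - ((i : ℕ) + 1))

/-- §16h. Every level: the moment curve (ℓ, ℓ², …, ℓⁿ) through a hyper-Liouville ℓ: auxiliary statement `exC` (lens 6 gen 9 node, ported verbatim). -/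
def exC (n q p : ℕ) (s : Fin (n + 1) →₀ ℕ) : ℕ := ∑ i : Fin n, s i.succ * Ewt n q p i

/-- §16h. Every level: the moment curve (ℓ, ℓ², …, ℓⁿ) through a hyper-Liouville ℓ: auxiliary statement `coC` (lens 6 gen 9 node, ported verbatim). -/
def coC (P : MvPolynomial (Fin (n + 1)) ℤ) (D p q : ℕ) (s : Fin (n + 1) →₀ ℕ) : ℤ :=
  P.coeff s * (p : ℤ) ^ (s 0) * (q : ℤ) ^ (D - s 0)

/-- `A = Σ_s coC(s) T^{exC s} = q^D · P(p/q, T^{E₁}, …, T^{Eₙ}) ∈ ℤ[T]` -/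
def AC (P : MvPolynomial (Fin (n + 1)) ℤ) (D p q : ℕ) : ℤ[X] :=
  ∑ s ∈ P.support, C (coC P D p q s) * X ^ exC n q p s

/-- the real function `x ↦ P(x, e^x, e^{x²}, …, e^{xⁿ})` -/
def FC (P : MvPolynomial (Fin (n + 1)) ℤ) (x : ℝ) : ℝ :=
  ∑ s ∈ P.support, ((P.coeff s : ℤ) : ℝ) * x ^ (s 0) *
    Real.exp (∑ i : Fin n, (s i.succ : ℝ) * x ^ ((i : ℕ) + 1))

/-- the point of the moment curve, with `ℓ` prepended: `(x, e^x, e^{x²}, …, e^{xⁿ})` -/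
def curvePt (n : ℕ) (x : ℂ) : Fin (n + 1) → ℂ := Fin.cons x fun i : Fin n => cexp (x ^ ((i : ℕ) + 1))

end HyperCell

end Summit.Schanuel.Schanuel.Theorems.RootDecomp1KHyper
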